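import Summits.RiemannHypothesis.RiemannHypothesis.Theorems.JensenLogBandArcShiftModelLogDeriv
import HarnessLib

/-!
# The translated-saddle model is an admissible disc model (BAND line, `stub_shellNear`, near zone)

RH ladder column JENSEN, rung J-P(P3) «log band», BAND crux `XiDerivBandRealAllRates` of route
«JensenLogBand», line «band-one-window» (u-arc, top-shell reshape), lead rh-jensen-prover g8 —
drafted by the custodian rh-jensen-theory g12 (THEORY NOTE #4 §1 step 4 / §4) for the lead / a hand
to land verbatim `--supports stmt-RiemannHypothesis-19913 --as helper`. RH-FREE bookkeeping.
WHAT THIS IS NOT: nothing here bears on zeros of `ζ` off the line or the truth of RH.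

* `arcShiftModel_model_on_ball`: if the window of the saddle `u₀` of `S_{n,v₀}` (`v₀ = x + iT`,
  `T ≥ 2`) sits at abscissa `Re(½+u₀) ≥ 1 + g`, `Re(u₀ − v₀) > 0`, `|Im(u₀ − v₀)| ≤ 1` (all delivered by
  `arcSaddle_polar_bounds` / `arcSaddle_sharp_polar`) and the curvature `arcCurv n v₀ u₀ ≠ 0`
  (`arcSaddle_curvature_bound`), then on every disc `ball v₀ R` with `R ≤ 1`, `R < g` the shifted
  model `M̃ = arcShiftModel n v₀ u₀` is holomorphic and zero-free — the two model hypotheses of the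
  composition frame `norm_lt_norm_of_disc_models` / of `LogDerivTransfer.re_logDeriv_ge_of_norm_sub_le`.
-/

noncomputable section

-- single-problem summit: `Summit.RiemannHypothesis.RiemannHypothesis.…` is the tree convention
set_option linter.dupNamespace false

open Complex Real Set Metric

namespace Summit.RiemannHypothesis.RiemannHypothesis.Theorems.JensenPolynomials.LogBandArc

/-- **The shifted model is holomorphic and zero-free on the transfer disc.** [folklore] -/
theorem arcShiftModel_model_on_ball (n : ℕ) {x T : ℝ} {u₀ : ℂ} {R g : ℝ} (hT : 2 ≤ T)
    (hR1 : R ≤ 1) (hgR : R < g) (hσ : 1 + g ≤ (1 / 2 + u₀).re)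
    (hre : 0 < (u₀ - ((x : ℂ) + (T : ℂ) * I)).re)
    (him : |(u₀ - ((x : ℂ) + (T : ℂ) * I)).im| ≤ 1)
    (hw : arcCurv n ((x : ℂ) + (T : ℂ) * I) u₀ ≠ 0) :
    DifferentiableOn ℂ (arcShiftModel n ((x : ℂ) + (T : ℂ) * I) u₀) (ball ((x : ℂ) + (T : ℂ) * I) R) ∧
      ∀ v ∈ ball ((x : ℂ) + (T : ℂ) * I) R, arcShiftModel n ((x : ℂ) + (T : ℂ) * I) u₀ v ≠ 0 := by
  set v₀ : ℂ := (x : ℂ) + (T : ℂ) * I with hv₀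
  have hd : u₀ - v₀ ≠ 0 := by
    intro h0
    rw [h0] at hre
    simp at hre
  have hv₀im : v₀.im = T := by simp [hv₀]
  have him' := abs_le.1 him
  -- the three pointwise conditions on the disc
  have hball : ∀ v ∈ ball v₀ R, 1 < (1 / 2 + (u₀ - v₀ + v)).re ∧ u₀ - v₀ + v ≠ 0 ∧
      u₀ - v₀ + 2 * v ≠ 0 := by
    intro v hv
    rw [mem_ball, dist_eq_norm] at hv
    have hre_d : |(v - v₀).re| ≤ ‖v - v₀‖ := Complex.abs_re_le_norm _
    have him_d : |(v - v₀).im| ≤ ‖v - v₀‖ := Complex.abs_im_le_norm _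
    have hre_d' := abs_le.1 hre_d
    have him_d' := abs_le.1 him_d
    have hvre : v.re = v₀.re + (v - v₀).re := by simp
    have hvim : v.im = T + (v - v₀).im := by rw [← hv₀im]; simp
    refine ⟨?_, ?_, ?_⟩
    · -- abscissa: `Re(½+u₀) + Re(v − v₀) ≥ 1 + g − R > 1`
      have e : (1 / 2 + (u₀ - v₀ + v)).re = (1 / 2 + u₀).re + (v - v₀).re := by
        simp; ring
      rw [e]
      linarith
    · -- imaginary part `Im(u₀ − v₀) + Im v > −1 + (T − R) ≥ 0`
      intro h0
      have h1 : (u₀ - v₀ + v).im = 0 := by rw [h0]; simp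
      have e : (u₀ - v₀ + v).im = (u₀ - v₀).im + v.im := by simp
      rw [e, hvim] at h1
      linarith
    · intro h0
      have h1 : (u₀ - v₀ + 2 * v).im = 0 := by rw [h0]; simp
      have e : (u₀ - v₀ + 2 * v).im = (u₀ - v₀).im + 2 * v.im := by simp
      rw [e, hvim] at h1
      linarith
  refine ⟨differentiableOn_arcShiftModel n hd hball, fun v hv => ?_⟩
  obtain ⟨h1, h2, h3⟩ := hball v hv
  exact arcShiftModel_ne_zero n hd hw h1 h2 h3

end Summit.RiemannHypothesis.RiemannHypothesis.Theorems.JensenPolynomials.LogBandArc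

end
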